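import Summits.RiemannHypothesis.RiemannHypothesis.Theorems.MotivicDoorAWSStructure

/-!
# Runbook sanity lemmas — motivic-door cell (`pub-rhdoor`), REVIEW-RUNBOOK §2 definition cards

Small computed values ((b)-type sanity lemmas) for the data definitions under the AWS headline theorem
`riemannHypothesis_of_arithmeticWeilSurface : Nonempty ArithmeticWeilSurface → RiemannHypothesis`:
the prime-side functionals of `Literature.NumberTheory.ConnesConsani2019` (`toMul`, `mulReflect`, `mulConv`, `massDstar`,
`massDu`, `ccN`, `ccPairing`) and the integer test combinations `testCombination` all vanish at the zero test function —
so the three PRIME-SIDE fields `frob_e₁`, `frob_e₂`, `frob_frob` of `ArithmeticWeilSurface` are consistent at the empty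
combination `c = 0` (both sides are `0`).  No inhabitant of `ArithmeticWeilSurface` is exhibited: by the headline theorem an
inhabitant yields the Riemann Hypothesis, so non-vacuity of the axiom system is exactly the open question (recorded as a
finding on the card, not as a lemma).  Generated for `harness/kit/review_runbook.py` (ops-runbook seat).
-/

set_option linter.dupNamespace false  -- the mandated namespace repeats `RiemannHypothesis` (as in every file of the cell)

namespace Summit.RiemannHypothesis.RiemannHypothesis.Runbook

open Summit.RiemannHypothesis.RiemannHypothesis.Theorems.MotivicDoor.AWS
open Literature.NumberTheory.ConnesConsani2019

/-- (b) the empty integer combination of any family is the zero test function. [folklore] -/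
theorem testCombination_zero {ι : Type*} (φ : ι → ℝ → ℝ) : testCombination φ 0 = 0 := by
  funext t
  simp [testCombination]

/-- (b) `toMul` (additive picture `u(t)` ↦ multiplicative picture `x^{-1/2} u(log x)`) maps `0` to `0`. [folklore] -/
theorem toMul_zero : toMul (0 : ℝ → ℝ) = 0 := by
  funext x
  simp [toMul]

/-- (b) the multiplicative reflection `f̃(u) = u⁻¹ f(u⁻¹)` of `0` is `0`. [folklore] -/
theorem mulReflect_zero : mulReflect (0 : ℝ → ℝ) = 0 := by
  funext u
  simp [mulReflect]

/-- (b) multiplicative convolution with the zero function on the left vanishes. [folklore] -/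
theorem mulConv_zero_left (g : ℝ → ℝ) : mulConv 0 g = 0 := by
  funext u
  simp [mulConv]

/-- (b) `∫ 0 d*u = 0`. [folklore] -/
theorem massDstar_zero : massDstar 0 = 0 := by
  simp [massDstar]

/-- (b) `∫ 0 du = 0`. [folklore] -/
theorem massDu_zero : massDu 0 = 0 := by
  simp [massDu]

/-- (b) the distribution `N` of CC 2019 eq. (16) pairs the zero test function to `0` (prime sum, archimedean integral and
the constant term all vanish). [folklore] -/
theorem ccN_zero : ccN 0 = 0 := by
  simp [ccN]

/-- (b) the form `𝔰(f, g) = N(f ⋆ g̃)` vanishes at `f = 0`. [folklore] -/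
theorem ccPairing_zero_left (g : ℝ → ℝ) : ccPairing 0 g = 0 := by
  simp [ccPairing, mulConv_zero_left, ccN_zero]

/-- (b) CONSISTENCY AT THE EMPTY COMBINATION: for `c = 0` the right-hand sides of the three prime-side fields of
`ArithmeticWeilSurface` (`frob_e₁`, `frob_e₂`, `frob_frob`) are all `0`, matching `inter 0 _ = 0` on the left. [folklore] -/
theorem primeSide_rhs_zero {ι : Type*} (φ : ι → ℝ → ℝ) :
    massDstar (toMul (testCombination φ 0)) = 0 ∧ massDu (toMul (testCombination φ 0)) = 0 ∧
      2 * ccPairing (toMul (testCombination φ 0)) (toMul (testCombination φ 0)) = 0 := by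
  simp [testCombination_zero, toMul_zero, massDstar_zero, massDu_zero, ccPairing_zero_left]

end Summit.RiemannHypothesis.RiemannHypothesis.Runbook
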